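import Literature.Computability.AlgebraicComplexity.DeterminantalComplexity
import Literature.Computability.AlgebraicComplexity.PencilFamily
import Literature.Computability.AlgebraicComplexity.StandardFamilies

/-!
# The admissible Białynicki-Birula limit of an affine representation of `per_n` is again one
# (stub S3 of `UlrichPadded.OrbitCorankTwo`)

Support file for the crux `UlrichPadded.OrbitCorankTwo` (stmt-ValiantsHypothesis-15032), line
`SketchIdeator1`, stub `orbitCorankTwo_bbLimit_isAffineDetRepr` (card bb-anchor "LimitIsRep").

Let `A = A₀ + L(x)` be an `m × m` affine determinantal representation of `per_n`
(`IsAffineDetRepr`: entries of total degree `≤ 1`, `det A = per_n`), write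
`a_ij = constantCoeff (A i j)`, `ℓ_ij = homogeneousComponent 1 (A i j)`, and let `α, β : Fin m → ℤ`
be integer row/column weights, `w_ij = α i + β j`. The weights are *admissible* when
`a_ij ≠ 0 → 0 ≤ w_ij`, `ℓ_ij ≠ 0 → -1 ≤ w_ij` and `∑ α + ∑ β = -n`; then the torus curve
`ρ_α(s) · A(s x) · ρ_β(s)` (entries `s^{w_ij} a_ij + s^{w_ij + 1} ℓ_ij`) is polynomial in `s` with
constant determinant `per_n`, and its value at `s = 0` is the matrix
`B i j = [w_ij = 0] a_ij + [w_ij = -1] ℓ_ij`. We prove, without introducing `s`, that `B` is an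
affine determinantal representation of `per_n`.

Proof. Affineness of `B` is immediate. For the determinant, expand both `det A` and `det B` by
`Matrix.det_apply` and each product of affine entries by `Fintype.prod_add` into a sum over subsets
`T` (positions where the constant part is picked). For a permutation `π` one has
`∑ i, w_{π i, i} = ∑ α + ∑ β = -n`. The `(π, T)` term of `det B` equals the `(π, T)` term of `det A`
when `|Tᶜ| = n` and vanishes otherwise (`bbLimit_term_eq`: if no factor vanishes, admissibility
gives `w ≥ 0` on `T` and `w ≥ -1` on `Tᶜ`, so `|Tᶜ| ≥ n` with all indicators true iff `|Tᶜ| = n`).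
Since the `(π, T)` term of `det A` is homogeneous of degree `|Tᶜ|`, this says
`det B = homogeneousComponent n (det A) = homogeneousComponent n per_n = per_n`.
-/

noncomputable section

namespace Summit.ValiantsHypothesis.Theorems

open MvPolynomial Matrix
open Literature.Computability.AlgebraicComplexity

/-- Combinatorial core of the Białynicki-Birula limit: for weights `w` with `∑ w = -n`, scalars
`c i` with `c i ≠ 0 → 0 ≤ w i` and `L i` with `L i ≠ 0 → -1 ≤ w i`, the weight-truncated product
over `(T, Tᶜ)` equals the untruncated one when `|Tᶜ| = n` and vanishes otherwise. [folklore] -/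
private theorem bbLimit_term_eq {ι R : Type*} [CommRing R] [Fintype ι] [DecidableEq ι]
    (n : ℕ) (w : ι → ℤ) (c L : ι → R)
    (h0 : ∀ i, c i ≠ 0 → 0 ≤ w i) (h1 : ∀ i, L i ≠ 0 → -1 ≤ w i)
    (hw : ∑ i, w i = -(n : ℤ)) (T : Finset ι) :
    (∏ i ∈ T, if w i = 0 then c i else 0) * (∏ i ∈ Tᶜ, if w i = -1 then L i else 0) =
      if n = Tᶜ.card then (∏ i ∈ T, c i) * ∏ i ∈ Tᶜ, L i else 0 := by
  have hsplit : ∑ i ∈ T, w i + ∑ i ∈ Tᶜ, w i = -(n : ℤ) := by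
    rw [Finset.sum_add_sum_compl, hw]
  split_ifs with hcard
  · -- `|Tᶜ| = n`
    by_cases hc : ∃ i ∈ T, c i = 0
    · obtain ⟨i, hi, hci⟩ := hc
      rw [Finset.prod_eq_zero hi (by rw [hci, ite_self]), Finset.prod_eq_zero hi hci,
        zero_mul, zero_mul]
    by_cases hL : ∃ i ∈ Tᶜ, L i = 0
    · obtain ⟨i, hi, hLi⟩ := hL
      rw [Finset.prod_eq_zero hi (by rw [hLi, ite_self]), Finset.prod_eq_zero hi hLi,
        mul_zero, mul_zero]
    push Not at hc hL
    have hT : ∀ i ∈ T, 0 ≤ w i := fun i hi => h0 i (hc i hi)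
    have hTc : ∀ i ∈ Tᶜ, 0 ≤ w i + 1 := fun i hi => by
      have := h1 i (hL i hi)
      omega
    have hone : ∑ i ∈ Tᶜ, (w i + 1) = ∑ i ∈ Tᶜ, w i + Tᶜ.card := by
      rw [Finset.sum_add_distrib, Finset.sum_const, nsmul_one]
    have hS1 : ∑ i ∈ T, w i = 0 := by
      have := Finset.sum_nonneg hT
      have := Finset.sum_nonneg hTc
      omega
    have hS2 : ∑ i ∈ Tᶜ, (w i + 1) = 0 := by
      have := Finset.sum_nonneg hT
      have := Finset.sum_nonneg hTc
      omega
    rw [Finset.sum_eq_zero_iff_of_nonneg hT] at hS1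
    rw [Finset.sum_eq_zero_iff_of_nonneg hTc] at hS2
    congr 1
    · exact Finset.prod_congr rfl fun i hi => if_pos (hS1 i hi)
    · exact Finset.prod_congr rfl fun i hi => if_pos (by have := hS2 i hi; omega)
  · -- `|Tᶜ| ≠ n`: some indicator is false
    by_contra hne
    have hT : ∀ i ∈ T, w i = 0 := by
      intro i hi
      by_contra hwi
      exact hne (by rw [Finset.prod_eq_zero hi (if_neg hwi), zero_mul])
    have hTc : ∀ i ∈ Tᶜ, w i = -1 := by
      intro i hi
      by_contra hwi
      exact hne (by rw [Finset.prod_eq_zero hi (if_neg hwi), mul_zero])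
    rw [Finset.sum_eq_zero hT, Finset.sum_congr rfl hTc, Finset.sum_const, zero_add,
      smul_neg, nsmul_one] at hsplit
    exact hcard (by omega)

/-- **Stub S3 (`LimitIsRep`).** The admissible Białynicki-Birula limit
`B i j = [α i + β j = 0] C (constantCoeff (A i j)) + [α i + β j = -1] homogeneousComponent 1 (A i j)`
of an affine determinantal representation `A` of `per_n` (weights with
`constantCoeff (A i j) ≠ 0 → 0 ≤ α i + β j`, `homogeneousComponent 1 (A i j) ≠ 0 → -1 ≤ α i + β j`,
`∑ α + ∑ β = -n`) is again an affine determinantal representation of `per_n`: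
`det B = homogeneousComponent n (det A) = per_n`, termwise in the expansion of the determinant
of a matrix of affine forms. [folklore] -/
theorem orbitCorankTwo_bbLimit_isAffineDetRepr :
    ∀ (n m : ℕ) (A : Matrix (Fin m) (Fin m) (MvPolynomial (Fin n × Fin n) ℂ)) (α β : Fin m → ℤ),
      IsAffineDetRepr (perPoly (Fin n) ℂ) A →
      (∀ i j, MvPolynomial.constantCoeff (A i j) ≠ 0 → 0 ≤ α i + β j) →
      (∀ i j, MvPolynomial.homogeneousComponent 1 (A i j) ≠ 0 → -1 ≤ α i + β j) →
      (∑ i, α i + ∑ j, β j = -(n : ℤ)) →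
      IsAffineDetRepr (perPoly (Fin n) ℂ) (Matrix.of fun i j =>
        (if α i + β j = 0 then MvPolynomial.C (MvPolynomial.constantCoeff (A i j)) else 0) +
        (if α i + β j = -1 then MvPolynomial.homogeneousComponent 1 (A i j) else 0)) := by
  intro n m A α β hA h0 h1 hsum
  obtain ⟨hdeg, hdet⟩ := hA
  refine ⟨fun i j => ?_, ?_⟩
  · -- affineness of the limit
    rw [Matrix.of_apply]
    refine (totalDegree_add _ _).trans (max_le ?_ ?_)
    · split_ifs
      · exact (totalDegree_C _).le.trans zero_le_one
      · exact totalDegree_zero.le.trans zero_le_one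
    · split_ifs
      · exact (homogeneousComponent_isHomogeneous 1 _).totalDegree_le
      · exact totalDegree_zero.le.trans zero_le_one
  · -- the determinant: `det B = homogeneousComponent n (det A) = per_n`
    have hper : homogeneousComponent n A.det = perPoly (Fin n) ℂ := by
      rw [hdet]
      have hh := perPoly_isHomogeneous (n := Fin n) (k := ℂ)
      rw [Fintype.card_fin] at hh
      exact homogeneousComponent_eq_self hh
    rw [← hper, Matrix.det_apply, Matrix.det_apply, map_sum]
    refine Finset.sum_congr rfl fun π _ => ?_
    rw [Units.smul_def, Units.smul_def, map_zsmul]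
    congr 1
    have hAe : ∀ i, A (π i) i =
        C (constantCoeff (A (π i) i)) + homogeneousComponent 1 (A (π i) i) := by
      intro i
      conv_lhs => rw [eq_homogeneousComponent_zero_add_one (hdeg (π i) i)]
      rw [homogeneousComponent_zero]
      rfl
    rw [show (∏ i, A (π i) i) =
        ∏ i, (C (constantCoeff (A (π i) i)) + homogeneousComponent 1 (A (π i) i)) from
      Finset.prod_congr rfl fun i _ => hAe i]
    simp only [Matrix.of_apply]
    rw [Fintype.prod_add, Fintype.prod_add, map_sum]
    refine Finset.sum_congr rfl fun T _ => ?_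
    have hw : ∑ i, (α (π i) + β i) = -(n : ℤ) := by
      rw [Finset.sum_add_distrib, Equiv.sum_comp π α]
      exact hsum
    have hc : ∀ i, (C (constantCoeff (A (π i) i)) : MvPolynomial (Fin n × Fin n) ℂ) ≠ 0 →
        0 ≤ α (π i) + β i :=
      fun i hC => h0 (π i) i fun h => hC (by rw [h, C_0])
    rw [bbLimit_term_eq n (fun i => α (π i) + β i) (fun i => C (constantCoeff (A (π i) i)))
      (fun i => homogeneousComponent 1 (A (π i) i)) hc (fun i hL => h1 (π i) i hL) hw T]
    have hhom : IsHomogeneous ((∏ i ∈ T, C (constantCoeff (A (π i) i))) *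
        ∏ i ∈ Tᶜ, homogeneousComponent 1 (A (π i) i)) Tᶜ.card := by
      have ha := IsHomogeneous.prod T
        (fun i => (C (constantCoeff (A (π i) i)) : MvPolynomial (Fin n × Fin n) ℂ)) (fun _ => 0)
        fun i _ => isHomogeneous_C _ _
      have hl := IsHomogeneous.prod Tᶜ (fun i => homogeneousComponent 1 (A (π i) i))
        (fun _ => 1) fun i _ => homogeneousComponent_isHomogeneous 1 _
      simp only [Finset.sum_const_zero, Finset.sum_const, smul_eq_mul, mul_one] at ha hl
      simpa only [zero_add] using ha.mul hl
    rw [homogeneousComponent_of_mem hhom]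

end Summit.ValiantsHypothesis.Theorems

end
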